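import Literature.MathematicalPhysics.QuantumFieldTheory.Balaban1983to89.B9Ineq349PConcrete
import Literature.MathematicalPhysics.QuantumFieldTheory.Balaban1983to89.B9Eq376DerivDict
import Literature.MathematicalPhysics.QuantumFieldTheory.Balaban1983to89.B9Ineq368Vprime

/-!
# `Balaban1983to89.B9Thm34GConcrete` — [Balaban1985BackgroundPropagators] Theorem 3.4 p. 400, `G`-clause, entries (3.42)₁ and (3.42)₃, for the
# CONCRETE perturbation `U′ = e^{iηA}` with EVERY `A`-DEPENDENT LETTER OF SECT. B CONCRETE: `V₃(A)` (3.82), `P₁(A)` (3.76), `P(U) = G′Q′*(Q′G′²Q′*)⁻¹Q′G′`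
# (3.25) and NOW `P′(A) = P(U′U) − P(U)` (3.68) built from the concrete `V′(A)` of (3.60) and the concrete `G′(U′U) = G′(U)Σ_n(V′G′(U))ⁿ` of (3.64)
# — FILE 15 of the Sect. B programme = FILE 13's `thm34_G_entries13_concreteP` with its four `P′`-entry hypotheses `hPp`/`hDPp`/`hPpDs`/`hDPpDs`
# DISCHARGED by gen 9/10's `B9Ineq368Vprime.ineq368_op{,_D,_Ds,_DDs}_conc` through FILE 14's derivative-letter dictionary, and its `G′(U)`-entries fed
# from the per-direction form of (3.42)₂,₃

statement-level skeleton of published theorems with citation tags; proofs where landed; nothing here is a claim about the Yang–Mills mass gap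

CITATION HEADER (lean-in-tree rule).  B9 = T. Bałaban, *Propagators for lattice gauge theories in a background field*, Commun. Math. Phys.
**99** (1985) 389–434 [Balaban1985BackgroundPropagators] (held `paper:balaban1985-cmp99-background-propagators`; journal page = PDF page + 388):
Thm 3.4 p. 400 («There exists a positive constant a₁ such that the operators G′(U), (Q′(U)G′²(U)Q′*(U))⁻¹, R(U), G(U) extend to configurations U′U
for α₁ ≦ a₁ as analytic functions of A. The extended operators satisfy all the inequalities of Theorems 3.1–3.3 correspondingly.»); the route pp. 400–407:
(3.50)–(3.54), (3.57)–(3.61), (3.62)–(3.68) («These results imply that the operators R(U), P(U) = I − R(U) extend analytically to the domain (3.37)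
and satisfy the same bounds … Moreover we have P(U′U) = P(U) + P′(A), [the bounds (3.68)]. The remainder can be written explicitly in terms of the
operators introduced until now by writing the expansions of the operators determining P(U′U).»), (3.69)–(3.77), (3.78)–(3.86); (3.25) p. 394, (3.19)
p. 394, (3.42) p. 397, (3.48) p. 398 and the two remarks p. 398, (3.35)/(3.37) p. 396.  [4] = [Balaban1984PropagatorsII] Lemma 2.1 p. 234, (2.51)–(2.55)
p. 232, (2.66) p. 234; [B11] = [Balaban1985Variational] (135) p. 298.  Cell `lit-balaban`, seat r06 (B9 fold owner) gen 12, FILE 15; rows B9.Thm3.4 ×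
B9.Eq3.68 × B9.Eq3.49 × B9.Eq3.60 × B9.Eq3.62 × B9.Eq3.76 × B9.Eq3.85.

WHAT THIS FILE PROVES (one theorem; 0 `def`; 0 sorry; standard axioms).
* **`thm34_G_entries13_allConcrete`** — FILE 13's `B9Ineq349PConcrete.thm34_G_entries13_concreteP` (coarse lattice `Z := S × ι` in p06/r06's block
  model, i.e. the averaging letters `Q′`, `Q′*`, `F′₂`, `F′₂*`, `C⁻¹`, `C⁻¹(U′U)`, `C′` typed as endomorphisms of the site carrier, as in every gen-9/10 file)
  with: (a) the remainder `P′(A)` WRITTEN OUT as `B9Eq360Vprime.pPrime G′ E Q′* Q′*(U′U) C⁻¹ C⁻¹(U′U) Q′ Q′(U′U)` for `E := gPrimeExtEnd G′ (V′G′)` ((3.64))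
  and `V′ := conj b (vPrimeConc …)` (the FULL concrete `V′(A)` of (3.60), `B9Eq360VprimeLetters`), and its four (3.68)-entries `hPp`/`hDPp`/`hPpDs`/`hDPpDs`
  DISCHARGED by `B9Ineq368Vprime.ineq368_op_conc` / `ineq368_op_D_conc` (left letter `∇_{inl μ}`) / `ineq368_op_Ds_conc` (right letter `∇_{inr ν}`) /
  `ineq368_op_DDs_conc` through FILE 14 (`hasMajorantHom_gradLin_comp`, `hasMajorantHom_comp_divLin`, `hasMajorant_gradLin_comp_comp_divLin`; the
  bonds → sites direction costs the factor `card κ`); (b) Theorem 3.1's entries for `G′(U)` in the per-direction form `h342_1`/`h342_2`/`h342_3` of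
  `B9Ineq368Vprime` (p. 398 «we may always replace ∇_U by ∇*_U … in arbitrary place and combination»), from which FILE 13's two-space inputs `hGp`/`hDGp`/
  `hGpDs` are produced by FILE 14 (`hasMajorantHom_gradLin`, `hasMajorantHom_divLin`) with the common constant `(1 + card κ)B_G`, so `κ_P = κ₃₄₉(κ_Q,
  (1 + card κ)B_G, B₁, Λ, c₁(β))`; (c) the constant `κ_{P′}` of the (3.77)-step subject to the two explicit domination conditions `hK1`, `hK3` (the
  (3.68)₁,₂- and `card κ ×` the (3.68)₃,₄-constants of `B9Ineq368Vprime`, with `B_D = B_G`).  RATES: the `P`/`P′` entries enter the (3.77)-step at `δ_P ≧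
  δ + 2(α+β)δ₀` (FILE 11); the (3.68) chain delivers `δ_P` from `δ_P + 2(2α+β)δ₀ ≦ (1 − 3α″)ρ₁`, `ρ₁ + (α+β)δ₀ ≦ δ_G` (`ρ₁` the rate of (3.63), `α″` the
  exponent of the Neumann steps (3.64)); the (3.49) chain needs only `δ_P + (2α+β)δ₀ ≦ δ_G`.

REMAINING INPUTS (all of printed shape, about `U` alone or structural): Theorem 3.1 (3.42)₁,₂,₃ for `G′(U)` (`h342_*`), Theorem 3.2 (3.48) for `C⁻¹(U)`
(`hCinv`), the `(Q′G′²Q′*)⁻¹`-clause letters `C⁻¹(U′U)` ((3.48)-shape, `hCinv'`) and `C′(A)` ((3.66)-shape, `hCp`) in resolvent form (3.67) (`hCC`) —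
concrete derivations exist: `B9Ineq366Vprime.hasMajorant_cPrimeHom_vPrime` / `inverse_satisfies_thm32_vPrime` —, `Q′(U′U) = Q′ + F′₂` ((3.57), `h357p`/
`h357ps`) with `Q′`, `F′₂` block-local ((3.19)/(3.59): `hQp`, `hQps`, `hFp`, `hFps`; the averaging kernels `kQ`, `kF`, `sQ`, `sF` and `a`-weights `cfun` of the
concrete `V′` with their sizes), Theorem 3.3's entries for `G(U)` (`hG`, `hDG`, `hGD`, `hGDs`), `Δ_a(U)G(U) = G(U)Δ_a(U) = 1` for the concrete `DRD*`,
the abstract `P₂` with (3.83)/(3.80), commuting shifts, group-valued background with (3.35) through each bond, (3.37) blockwise, `η = g.eta > 0`, `L ≧ 1`,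
`ηα₁(Lʲη)⁻¹ ≦ 1/4`, stencil geometry, Lemma 2.1 of [4] at three rates with scale transfers, three smallness conditions (`hθ`, `hθL`: (3.63)/(3.64);
`hsmall385`: (3.86)).

HONEST SCOPE / NOT CLAIMED.  Operator (block `L^∞`) form throughout; entries (3.42)₂,₄ and (3.43)–(3.47) for `G(U′U)` not here; the printed pointwise
kernel factors `(L^{j′}η)^{−d}` not used; no kernel ↔ block identification; no analyticity statement (the Neumann series are finite-lattice inverses);
no row head changes.  Value = Theorem 3.4's `G`-clause (entries 1, 3) for the concrete perturbation with every `A`-dependent letter of pp. 400–407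
concrete and kernel-checked, resting on Theorems 3.1–3.3 for `U` and the structural letters only; NOT summit progress.

RELATED IN THE TREE, NOT DUPLICATED (searched 2026-08-22: `lean search 'Thm34GConcrete|thm34_G_entries13_allConcrete'` = ∅): FILES 13/14 and
`B9Ineq368Vprime` are used BY NAME; nothing restated.
-/

noncomputable section

namespace Literature.MathematicalPhysics.QuantumFieldTheory.Balaban1983to89.B9Thm34GConcrete

open NormedSpace Complex
open Literature.MathematicalPhysics.QuantumFieldTheory.Balaban1983to89
open Literature.MathematicalPhysics.QuantumFieldTheory.Balaban1983to89.B6RandomWalk (HasMajorant hasMajorant_mono Triangle254 Ineq261)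
open Literature.MathematicalPhysics.QuantumFieldTheory.Balaban1983to89.B6RandomWalkHom (HasMajorantHom hasMajorantHom_mono hasMajorantHom_iff)
open Literature.MathematicalPhysics.QuantumFieldTheory.Balaban1983to89.B9Thm34Ext (toB6)
open Literature.MathematicalPhysics.QuantumFieldTheory.Balaban1983to89.B9Ineq347 (ScaleTransfer)
open Literature.MathematicalPhysics.QuantumFieldTheory.Balaban1983to89.B9Eq386Neumann (pTwo deltaA)
open Literature.MathematicalPhysics.QuantumFieldTheory.Balaban1983to89.B9Ineq377POne (kappa377)
open Literature.MathematicalPhysics.QuantumFieldTheory.Balaban1983to89.B9Ineq385VG (kappa385)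
open Literature.MathematicalPhysics.QuantumFieldTheory.Balaban1983to89.B9Eq39Adjoint
open Literature.MathematicalPhysics.QuantumFieldTheory.Balaban1983to89.B9Eq369Small (Through)
open Literature.MathematicalPhysics.QuantumFieldTheory.Balaban1983to89.B9Eq372Locality (stBonds)
open Literature.MathematicalPhysics.QuantumFieldTheory.Balaban1983to89.B9Eq352DivForm (tauF tauB)
open Literature.MathematicalPhysics.QuantumFieldTheory.Balaban1983to89.B9Eq352DivFormLetters
open Literature.MathematicalPhysics.QuantumFieldTheory.Balaban1983to89.B9Eq352GradLetters (diffLetter)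
open Literature.MathematicalPhysics.QuantumFieldTheory.Balaban1983to89.B9Eq371GradLetters (bT bU)
open Literature.MathematicalPhysics.QuantumFieldTheory.Balaban1983to89.B9Eq372RemLetters
open Literature.MathematicalPhysics.QuantumFieldTheory.Balaban1983to89.B9Eq382V3Letters
open Literature.MathematicalPhysics.QuantumFieldTheory.Balaban1983to89.B9Ineq385V3Concrete (cV385)
open Literature.MathematicalPhysics.QuantumFieldTheory.Balaban1983to89.B9Eq376POneLetters
open Literature.MathematicalPhysics.QuantumFieldTheory.Balaban1983to89.B9Ineq368PPrime (kappa349 kappa368)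
open Literature.MathematicalPhysics.QuantumFieldTheory.Balaban1983to89.B9Ineq368PPrimeDs (kappa368Ds)
open Literature.MathematicalPhysics.QuantumFieldTheory.Balaban1983to89.B9Eq360Vprime (gPrimeExtEnd)
open Literature.MathematicalPhysics.QuantumFieldTheory.Balaban1983to89.B9Eq360VprimeLetters (vPrimeConc cBConc cCConc)
open Literature.MathematicalPhysics.QuantumFieldTheory.Balaban1983to89.B9Ineq363Vprime (cVConc theta363 thetaL363)
open Literature.MathematicalPhysics.QuantumFieldTheory.Balaban1983to89.B9Ineq368Vprime (ineq368_op_conc ineq368_op_D_conc ineq368_op_Ds_conc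
  ineq368_op_DDs_conc)
open Literature.MathematicalPhysics.QuantumFieldTheory.Balaban1983to89.B9Ineq349PConcrete (thm34_G_entries13_concreteP)
open Literature.MathematicalPhysics.QuantumFieldTheory.Balaban1983to89.B9Eq376DerivDict (hasMajorantHom_gradLin_comp hasMajorantHom_gradLin
  hasMajorantHom_comp_divLin hasMajorantHom_divLin hasMajorant_gradLin_comp_comp_divLin)

section Assembly

variable {𝔸 : Type*} [NormedRing 𝔸] [NormedAlgebra ℂ 𝔸] [CompleteSpace 𝔸] {ι : Type} [Fintype ι]
variable (b : Module.Basis ι ℝ 𝔸) {S : Type} {κ : Type} [Fintype κ] [LinearOrder κ]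
variable (T : κ → Equiv.Perm S) (U : κ → S → 𝔸ˣ)
variable {g : B9.Geometry} [Fintype g.Site] {Rr : ℝ} {H : Prop}

/-- **THEOREM 3.4, `G`-CLAUSE, ENTRIES (3.42)₁ AND (3.42)₃, FOR THE CONCRETE PERTURBATION WITH `V₃(A)`, `P₁(A)`, `P(U)` AND `P′(A)` ALL CONCRETE**
(FILE 13's `thm34_G_entries13_concreteP` at `Z := S × ι` with `P′(A) := pPrime G′ (gPrimeExtEnd G′ (V′G′)) Q′* Q′*(U′U) C⁻¹ C⁻¹(U′U) Q′ Q′(U′U)`,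
`V′ = conj b (vPrimeConc T U η A blk kQ kF sQ sF c)`, whose (3.68) entries are the theorems `B9Ineq368Vprime.ineq368_op{,_D,_Ds,_DDs}_conc` read through
FILE 14's dictionary; Theorem 3.1 for `G′(U)` in the per-direction form).  CONCLUSION (FILE 13's): a two-sided inverse `G(U′U)` of `Δ_a(U′U)` — with
`D′R′D′* = D′ ∘ (1 − (G′Q′*C⁻¹Q′G′ + P′(A))) ∘ D′*` concrete — with `G(U′U) ≺ B₀c₁(α′)(1 − κ₃₈₅′α₁c₁(α′))⁻¹(Lʲη)²e^{−(1−α′)ρd}` and `G(U′U)·∇* ≺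
B₀Λ_ρ²c₁(α′)(1 − κ₃₈₅′α₁c₁(α′))⁻¹Lʲη·e^{−(1−3α′)ρd}`.
[cite: Balaban1985BackgroundPropagators, Thm 3.4 p.400 + (3.68) p.403 + (3.60)–(3.65) p.402 + (3.25) p.394 + (3.49) p.399 + Thm 3.1 (3.42) p.397 + Thm 3.2 (3.48) p.398 + remark p.398 + (3.76)–(3.77) pp.405–406 + (3.82)–(3.86) p.407 + (3.37)/(3.35) p.396; Balaban1984PropagatorsII, Lemma 2.1 p.234 + (2.51)–(2.55) p.232 + (2.66) p.234; Balaban1985Variational, (135) p.298] -/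
theorem thm34_G_entries13_allConcrete [Fintype S] [DecidableEq S] [DecidableEq ι] [DecidableEq g.Site] (blk : S → g.Site) (d : ℕ)
    (δ₀ δ δP δG α β ρ α' ρ₁ α'' Λ Λρ Λρ₁ B₀ κQ BG B₁ Bc' κC cF Cq a₀ κP κP' κ₁ κ₂ α₁ C₀ d₀ M₂ : ℝ)
    (kQ kF : g.Site → S → 𝔸 →L[ℝ] 𝔸) (sQ sF : S → 𝔸 →L[ℝ] 𝔸) (cfun w : g.Site → ℝ)
    (hB₀ : 0 ≤ B₀) (hκQ : 0 ≤ κQ) (hBG : 0 ≤ BG) (hB₁ : 0 ≤ B₁) (hBc' : 0 ≤ Bc') (hκC : 0 ≤ κC) (hcF : 0 ≤ cF) (hCq : 0 ≤ Cq) (ha₀ : 0 ≤ a₀) (hκP' : 0 ≤ κP') (hκ₂ : 0 ≤ κ₂) (hα₁ : 0 ≤ α₁) (hC₀ : 0 ≤ C₀) (hΛ : 1 ≤ Λ) (hΛρ : 0 ≤ Λρ)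
    (hρ : 0 ≤ ρ) (hα : 0 ≤ α) (hβ : 0 ≤ β) (hδ₀ : 0 ≤ δ₀) (hδ : 0 ≤ δ) (hM₂ : 0 ≤ M₂) (hr : ρ + (α + β) * δ₀ ≤ δ)
    (hrP : δ + 2 * ((α + β) * δ₀) ≤ δP) (hrG : δP + (2 * α + β) * δ₀ ≤ δG)
    (hr1 : ρ₁ + (α + β) * δ₀ ≤ δG) (hα''1 : α'' ≤ 1) (hα''0 : 0 ≤ α'') (hρ₁ : 0 ≤ ρ₁) (hα''ρ : 0 ≤ (1 - α'') * ρ₁)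
    (hα''ρ2 : 0 ≤ (1 - 2 * α'') * ρ₁) (hα''ρ3 : 0 ≤ (1 - 3 * α'') * ρ₁) (hΛρ₁ : 0 ≤ Λρ₁)
    (hr368 : δP + 2 * ((2 * α + β) * δ₀) ≤ B9Ineq368Vprime.rateC α'' ρ₁)
    (hκP : κP = kappa349 κQ ((1 + Fintype.card κ) * BG) B₁ Λ (B6.c1 d δ₀ β)) (hα' : α' ≤ 1) (hα'ρ0 : 0 ≤ α' * ρ) (hα'ρ2 : 0 ≤ (1 - 2 * α') * ρ)
    (hκ₁ : κ₁ = kappa377 (4 * (1 + Fintype.card κ) * (M₂ * ∑ i, ‖b i‖) * Real.exp (δP * d₀)) κP κP' Λ (B6.c1 d δ₀ β) α₁)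
    (hdnn : ∀ a a' : g.Site, 0 ≤ g.dist a a') (htri : Triangle254 (toB6 g Rr H)) (hrefl : ∀ y : g.Site, g.dist y y = 0)
    (hsym : ∀ y y' : g.Site, g.dist y y' = g.dist y' y) (hlen : ∀ y : g.Site, 0 < g.len y)
    (h261 : Ineq261 d (toB6 g Rr H) δ₀ β) (h261' : Ineq261 d (toB6 g Rr H) ρ α') (h261'' : Ineq261 d (toB6 g Rr H) ρ₁ α'')
    (hT1 : ScaleTransfer g δ₀ α Λ (fun a => g.len a)) (hT2 : ScaleTransfer g δ₀ α Λ (fun a => g.len a ^ 2))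
    (hT1i : ScaleTransfer g δ₀ α Λ (fun a => (g.len a)⁻¹)) (hT2i : ScaleTransfer g δ₀ α Λ (fun a => (g.len a ^ 2)⁻¹))
    (hT4 : ScaleTransfer g δ₀ α Λ (fun a => (g.len a ^ 4)⁻¹))
    (hTρ : ScaleTransfer g ρ α' Λρ (fun a => g.len a))
    (hTρ₁ : ScaleTransfer g ρ₁ α'' Λρ₁ (fun a => g.len a))
    (hsmall385 : kappa385 B₀
        (cV385 (Fintype.card κ) α₁ C₀ (M₂ * (∑ i, ‖b i‖) * Real.exp (δ * d₀))
          + ∑ _k ∈ (Finset.univ : Finset (κ ⊕ κ)),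
            (10 + 8 * Fintype.card κ + (16 * Fintype.card κ + 12) * C₀) * (M₂ * (∑ i, ‖b i‖) * Real.exp (δ * d₀)))
        κ₁ κ₂ Λ (B6.c1 d δ₀ β) * α₁ * B6.c1 d ρ α' < 1)
    (hrepr : ∀ (v : 𝔸) (i : ι), |b.repr v i| ≤ M₂ * ‖v‖) (hη : 0 < g.eta) (hL : 1 ≤ g.L) (A : κ → S → 𝔸)
    (hT : ∀ (μ ν : κ) (x : S), T μ (T ν x) = T ν (T μ x))
    (hsmall : ∀ y : g.Site, g.eta * (α₁ * (g.len y)⁻¹) ≤ 1 / 4)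
    (hU1 : ∀ m z, ‖((U m z : 𝔸ˣ) : 𝔸)‖ ≤ 1 ∧ ‖(((U m z)⁻¹ : 𝔸ˣ) : 𝔸)‖ ≤ 1)
    -- (3.37) for the exponent field, blockwise, in the shapes files 1–10 read it
    (h337B : ∀ ν k x, ‖((g.eta : ℂ)⁻¹) • covDstar T U ν (A k) x‖ ≤ α₁ * (g.len (blk x) ^ 2)⁻¹)
    (h337F : ∀ μ ν x, ‖((g.eta : ℂ)⁻¹) • covD T U μ (A ν) x‖ ≤ α₁ * (g.len (blk x) ^ 2)⁻¹)
    (h337B' : ∀ μ ν x, ‖((g.eta : ℂ)⁻¹) • covDstar T U ν (A ν) (T μ x)‖ ≤ α₁ * (g.len (blk x) ^ 2)⁻¹)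
    (h337Bτ : ∀ μ x, ‖((g.eta : ℂ)⁻¹) • covDstar T U μ (tauB T U μ (A μ)) x‖ ≤ α₁ * (g.len (blk x) ^ 2)⁻¹)
    (h337FB : ∀ μ ν k x, ‖((g.eta : ℂ)⁻¹) • covD T U μ (A k) ((T ν).symm x)‖ ≤ α₁ * (g.len (blk x) ^ 2)⁻¹)
    (hA : ∀ k x, ‖A k x‖ ≤ α₁ * (g.len (blk x))⁻¹) (hAτB : ∀ ν k x, ‖tauB T U ν (A k) x‖ ≤ α₁ * (g.len (blk x))⁻¹)
    (hAτF : ∀ μ k x, ‖tauF T U μ (A k) x‖ ≤ α₁ * (g.len (blk x))⁻¹)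
    (hAFB : ∀ k μ ν x, ‖A k ((T ν).symm (T μ x))‖ ≤ α₁ * (g.len (blk x))⁻¹)
    (hAst : ∀ μ x m z, (m, z) ∈ stBonds T μ x → ‖A m z‖ ≤ α₁ * (g.len (blk x))⁻¹)
    (hAloc : ∀ μ x m z, (m, z) ∈ B9Eq375Locality.locBondsA T μ x → ‖A m z‖ ≤ α₁ * (g.len (blk x))⁻¹)
    (hdAst : ∀ μ x m n y, Through T μ x m n y →
      ‖covD T U m (A n) y‖ ≤ g.eta * (α₁ * ((g.len (blk x))⁻¹) ^ 2) ∧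
        ‖covD T U n (A m) y‖ ≤ g.eta * (α₁ * ((g.len (blk x))⁻¹) ^ 2))
    -- (3.35) on the plaquettes through each bond, at that bond's block scale
    (h35 : ∀ μ x m n y, Through T μ x m n y → ‖(plaqU T U m n y : 𝔸) - 1‖ ≤ C₀ * ((g.L ^ g.scale (blk x))⁻¹) ^ 2)
    -- stencil geometry
    (hd₀B : ∀ μ x, g.dist (blk x) (blk ((T μ).symm x)) ≤ d₀) (hd₀F : ∀ μ x, g.dist (blk x) (blk (T μ x)) ≤ d₀)
    (hd₀FB : ∀ μ ν x, g.dist (blk x) (blk ((T ν).symm (T μ x))) ≤ d₀)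
    (hd₀st : ∀ μ x (q : κ × S), q ∈ stBonds T μ x → g.dist (blk x) (blk q.2) ≤ d₀)
    (hd₀loc : ∀ μ x (q : κ × S), q ∈ B9Eq375Locality.locBondsA' T μ x → g.dist (blk x) (blk q.2) ≤ d₀)
    (hd₀0 : ∀ y : g.Site, g.dist y y ≤ d₀)
    -- the letters of `P(U) = G′Q′*(Q′G′²Q′*)⁻¹Q′G′` ((3.25)) and of `P′(A)` ((3.57), (3.65), (3.67)) ON THE SITE CARRIER `S × ι`,
    -- Theorem 3.1 (3.42)₁,₂,₃ for `G′(U)` with the DIRECTIONAL derivative letters (p. 398: the choice `∇`/`∇*` is conventional),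
    -- Theorem 3.2 (3.48) for `C⁻¹(U) = (Q′G′²Q′*)⁻¹` and for `C⁻¹(U′U)`, (3.66) for `C′(A)` in resolvent form (3.67), `Q′`/`Q′*` ((3.19)) and
    -- `F′₂`/`F′₂*` ((3.59)) block-local — all at the rate `δ_G`
    {Gp Qp Qps Qp' Qps' Fp₂ Fp₂s Cinv Cinv' Cp : Module.End ℝ (S × ι → ℝ)}
    (h342_1 : HasMajorant (g := toB6 g Rr H) (fun p : S × ι => blk p.1) Gp
      (fun a a' => BG * g.len a ^ 2 * Real.exp (-(δG * g.dist a a'))))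
    (h342_2 : ∀ k : κ ⊕ κ, HasMajorant (g := toB6 g Rr H) (fun p : S × ι => blk p.1)
      (conj b (diffLetter T U ((g.eta : ℂ)⁻¹) k) * Gp) (fun a a' => BG * g.len a * Real.exp (-(δG * g.dist a a'))))
    (h342_3 : ∀ k : κ ⊕ κ, HasMajorant (g := toB6 g Rr H) (fun p : S × ι => blk p.1)
      (Gp * conj b (diffLetter T U ((g.eta : ℂ)⁻¹) k)) (fun a a' => BG * g.len a * Real.exp (-(δG * g.dist a a'))))
    (h357p : Qp' = Qp + Fp₂) (h357ps : Qps' = Qps + Fp₂s) (hCC : Cinv' - Cinv = -(Cinv' * Cp * Cinv))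
    (hQp : HasMajorant (g := toB6 g Rr H) (fun p : S × ι => blk p.1) Qp (fun a a' : g.Site => if a = a' then κQ else 0))
    (hQps : HasMajorant (g := toB6 g Rr H) (fun p : S × ι => blk p.1) Qps (fun a a' : g.Site => if a = a' then κQ else 0))
    (hFp : HasMajorant (g := toB6 g Rr H) (fun p : S × ι => blk p.1) Fp₂ (fun a a' : g.Site => if a = a' then cF * α₁ else 0))
    (hFps : HasMajorant (g := toB6 g Rr H) (fun p : S × ι => blk p.1) Fp₂s (fun a a' : g.Site => if a = a' then cF * α₁ else 0))
    (hCinv : HasMajorant (g := toB6 g Rr H) (fun p : S × ι => blk p.1) Cinv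
      (fun a a' => B₁ * (g.len a ^ 4)⁻¹ * Real.exp (-(δG * g.dist a a'))))
    (hCinv' : HasMajorant (g := toB6 g Rr H) (fun p : S × ι => blk p.1) Cinv'
      (fun a a' => Bc' * (g.len a ^ 4)⁻¹ * Real.exp (-(δG * g.dist a a'))))
    (hCp : HasMajorant (g := toB6 g Rr H) (fun p : S × ι => blk p.1) Cp
      (fun a a' => κC * α₁ * g.len a ^ 4 * Real.exp (-(δG * g.dist a a'))))
    -- the data of the CONCRETE `V′(A)` of (3.60) (`B9Eq360VprimeLetters.vPrimeConc`): averaging kernels and their sizes ((3.19), (3.59)), the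
    -- `a`-weights ((3.24)), and the two smallness conditions of `B9Ineq363Vprime` («for α₁ sufficiently small», p. 402)
    (hw : ∀ y, 0 ≤ w y) (hcard : ∀ y, ((B9Eq360Vprime.block blk y).card : ℝ) * w y ≤ 1)
    (hkQ : ∀ y x, blk x = y → ‖kQ y x‖ ≤ w y) (hkF : ∀ y x, blk x = y → ‖kF y x‖ ≤ Cq * α₁ * w y)
    (hsQ : ∀ x, ‖sQ x‖ ≤ 1) (hsF : ∀ x, ‖sF x‖ ≤ Cq * α₁) (hcfun : ∀ y, |cfun y| ≤ a₀ * (g.len y ^ 2)⁻¹)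
    (hθ : theta363 (Fintype.card κ) 1 α₁ a₀ Cq M₂ (∑ i, ‖b i‖) (Real.exp (δG * d₀)) BG Λ (B6.c1 d δ₀ β) *
      B6.c1 d ρ₁ α'' < 1)
    (hθL : thetaL363 (Fintype.card κ) 1 α₁ a₀ Cq M₂ (∑ i, ‖b i‖) (Real.exp (δG * d₀)) BG Λ (B6.c1 d δ₀ β) *
      B6.c1 d ρ₁ α'' < 1)
    -- the constant `κ_{P′}` of the (3.77)-step dominates the four explicit (3.68)-constants of `B9Ineq368Vprime`
    (hK1 : kappa368 κQ cF
        (kappa385 1 (cVConc (Fintype.card κ) 1 α₁ a₀ Cq M₂ (∑ i, ‖b i‖) (Real.exp (δG * d₀))) 0 0 Λ (B6.c1 d δ₀ β))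
        κC BG BG (BG * B6.c1 d ρ₁ α'' *
          (1 - theta363 (Fintype.card κ) 1 α₁ a₀ Cq M₂ (∑ i, ‖b i‖) (Real.exp (δG * d₀)) BG Λ (B6.c1 d δ₀ β) * B6.c1 d ρ₁ α'')⁻¹)
        B₁ Bc' Λ (B6.c1 d δ₀ β) α₁ ≤ κP')
    (hK3 : Fintype.card κ * kappa368Ds κQ cF
        (kappa385 BG (cVConc (Fintype.card κ) 1 α₁ a₀ Cq M₂ (∑ i, ‖b i‖) (Real.exp (δG * d₀))) 0 0 Λ (B6.c1 d δ₀ β))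
        κC BG BG BG (B6.c1 d ρ₁ α'' *
          (1 - theta363 (Fintype.card κ) 1 α₁ a₀ Cq M₂ (∑ i, ‖b i‖) (Real.exp (δG * d₀)) BG Λ (B6.c1 d δ₀ β) * B6.c1 d ρ₁ α'')⁻¹)
        (BG * Λρ₁ ^ 2 * B6.c1 d ρ₁ α'' *
          (1 - thetaL363 (Fintype.card κ) 1 α₁ a₀ Cq M₂ (∑ i, ‖b i‖) (Real.exp (δG * d₀)) BG Λ (B6.c1 d δ₀ β) * B6.c1 d ρ₁ α'')⁻¹)
        B₁ Bc' (cBConc (Fintype.card κ) M₂ (∑ i, ‖b i‖) (Real.exp (B9Ineq368Vprime.rateC α'' ρ₁ * d₀)))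
        (cCConc (Fintype.card κ) 1 α₁ a₀ Cq M₂ (∑ i, ‖b i‖) (Real.exp (B9Ineq368Vprime.rateC α'' ρ₁ * d₀))) Λ (B6.c1 d δ₀ β) α₁
        ≤ κP')
    -- the abstract data of (3.80), the inverse property for the concrete `DRD*` and Theorem 3.3 for G(U)
    {G Ds P₂ Qs Qs' Q Q' a F₂ F₂s : Module.End ℝ ((κ × S) × ι → ℝ)}
    (h380 : Q' = Q + F₂) (h380s : Qs' = Qs + F₂s) (hP₂def : P₂ = pTwo Qs Q F₂ F₂s a)
    (hΔG : deltaA (conj b (lapDDLetter T ((g.eta : ℂ)⁻¹) U)) (conj b (dPrimeLetter T U g.eta))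
      (conjHom b (gradLin T ((g.eta : ℂ)⁻¹) U) ∘ₗ (1 - (Gp ∘ₗ Qps ∘ₗ Cinv ∘ₗ Qp ∘ₗ Gp)) ∘ₗ conjHom b (divLin T ((g.eta : ℂ)⁻¹) U)) Qs a Q * G = 1)
    (hGΔ : G * deltaA (conj b (lapDDLetter T ((g.eta : ℂ)⁻¹) U)) (conj b (dPrimeLetter T U g.eta))
      (conjHom b (gradLin T ((g.eta : ℂ)⁻¹) U) ∘ₗ (1 - (Gp ∘ₗ Qps ∘ₗ Cinv ∘ₗ Qp ∘ₗ Gp)) ∘ₗ conjHom b (divLin T ((g.eta : ℂ)⁻¹) U)) Qs a Q = 1)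
    (hP₂ : HasMajorant (g := toB6 g Rr H) (fun q : (κ × S) × ι => blk q.1.2) P₂
      (fun a a' => κ₂ * α₁ * (g.len a ^ 2)⁻¹ * Real.exp (-(δ * g.dist a a'))))
    (hG : HasMajorant (g := toB6 g Rr H) (fun q : (κ × S) × ι => blk q.1.2) G
      (fun a a' => B₀ * g.len a ^ 2 * Real.exp (-(δ * g.dist a a'))))
    (hDG : ∀ k : κ ⊕ κ, HasMajorant (g := toB6 g Rr H) (fun q : (κ × S) × ι => blk q.1.2)
      (conj b (diffLetter (bT T) (bU U) ((g.eta : ℂ)⁻¹) k) * G) (fun a a' => B₀ * g.len a * Real.exp (-(δ * g.dist a a'))))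
    (hGD : ∀ k : κ ⊕ κ, HasMajorant (g := toB6 g Rr H) (fun q : (κ × S) × ι => blk q.1.2)
      (G * conj b (diffLetter (bT T) (bU U) ((g.eta : ℂ)⁻¹) k)) (fun a a' => B₀ * g.len a * Real.exp (-(δ * g.dist a a'))))
    (hGDs : HasMajorant (g := toB6 g Rr H) (fun q : (κ × S) × ι => blk q.1.2) (G * Ds)
      (fun a a' => B₀ * g.len a * Real.exp (-(δ * g.dist a a')))) :
    ∃ GExt : Module.End ℝ ((κ × S) × ι → ℝ),
      deltaA (conj b (lapDDLetter T ((g.eta : ℂ)⁻¹) (prodCfg U g.eta A)))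
          (conj b (dPrimeLetter T (prodCfg U g.eta A) g.eta))
          (conjHom b (gradLin T ((g.eta : ℂ)⁻¹) (prodCfg U g.eta A)) ∘ₗ (1 - ((Gp ∘ₗ Qps ∘ₗ Cinv ∘ₗ Qp ∘ₗ Gp) + (B9Eq360Vprime.pPrime Gp (gPrimeExtEnd Gp (conj b (vPrimeConc T U g.eta A blk kQ kF sQ sF cfun) * Gp)) Qps Qps' Cinv Cinv' Qp Qp')))
            ∘ₗ conjHom b (divLin T ((g.eta : ℂ)⁻¹) (prodCfg U g.eta A))) Qs' a Q' * GExt = 1 ∧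
      GExt * deltaA (conj b (lapDDLetter T ((g.eta : ℂ)⁻¹) (prodCfg U g.eta A)))
          (conj b (dPrimeLetter T (prodCfg U g.eta A) g.eta))
          (conjHom b (gradLin T ((g.eta : ℂ)⁻¹) (prodCfg U g.eta A)) ∘ₗ (1 - ((Gp ∘ₗ Qps ∘ₗ Cinv ∘ₗ Qp ∘ₗ Gp) + (B9Eq360Vprime.pPrime Gp (gPrimeExtEnd Gp (conj b (vPrimeConc T U g.eta A blk kQ kF sQ sF cfun) * Gp)) Qps Qps' Cinv Cinv' Qp Qp')))
            ∘ₗ conjHom b (divLin T ((g.eta : ℂ)⁻¹) (prodCfg U g.eta A))) Qs' a Q' = 1 ∧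
      HasMajorant (g := toB6 g Rr H) (fun q : (κ × S) × ι => blk q.1.2) GExt
        (fun a a' => B₀ * B6.c1 d ρ α' *
          (1 - kappa385 B₀
            (cV385 (Fintype.card κ) α₁ C₀ (M₂ * (∑ i, ‖b i‖) * Real.exp (δ * d₀))
              + ∑ _k ∈ (Finset.univ : Finset (κ ⊕ κ)),
                (10 + 8 * Fintype.card κ + (16 * Fintype.card κ + 12) * C₀) * (M₂ * (∑ i, ‖b i‖) * Real.exp (δ * d₀)))
            κ₁ κ₂ Λ (B6.c1 d δ₀ β) * α₁ * B6.c1 d ρ α')⁻¹ *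
          g.len a ^ 2 * Real.exp (-((1 - α') * ρ * g.dist a a'))) ∧
      HasMajorant (g := toB6 g Rr H) (fun q : (κ × S) × ι => blk q.1.2) (GExt * Ds)
        (fun a a' => B₀ * Λρ ^ 2 * B6.c1 d ρ α' *
          (1 - kappa385 B₀
            (cV385 (Fintype.card κ) α₁ C₀ (M₂ * (∑ i, ‖b i‖) * Real.exp (δ * d₀))
              + ∑ _k ∈ (Finset.univ : Finset (κ ⊕ κ)),
                (10 + 8 * Fintype.card κ + (16 * Fintype.card κ + 12) * C₀) * (M₂ * (∑ i, ‖b i‖) * Real.exp (δ * d₀)))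
            κ₁ κ₂ Λ (B6.c1 d δ₀ β) * α₁ * B6.c1 d ρ α')⁻¹ *
          g.len a * Real.exp (-((1 - 3 * α') * ρ * g.dist a a'))) := by
  have hcardκ : (0 : ℝ) ≤ Fintype.card κ := Nat.cast_nonneg _
  have hαβ : 0 ≤ (α + β) * δ₀ := mul_nonneg (add_nonneg hα hβ) hδ₀
  have h2αβ : 0 ≤ (2 * α + β) * δ₀ := mul_nonneg (add_nonneg (mul_nonneg zero_le_two hα) hβ) hδ₀
  have hδP0 : 0 ≤ δP :=
    le_trans (add_nonneg hδ (mul_nonneg zero_le_two hαβ)) hrP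
  have hδG0 : 0 ≤ δG := le_trans (le_trans hδP0 (le_add_of_nonneg_right h2αβ)) hrG
  have hBG' : 0 ≤ (1 + Fintype.card κ) * BG := mul_nonneg (add_nonneg zero_le_one hcardκ) hBG
  have hBGle : BG ≤ (1 + Fintype.card κ) * BG := by
    have h : (1 : ℝ) ≤ 1 + Fintype.card κ := le_add_of_nonneg_right hcardκ
    simpa using mul_le_mul_of_nonneg_right h hBG
  have hκBGle : Fintype.card κ * BG ≤ (1 + Fintype.card κ) * BG :=
    mul_le_mul_of_nonneg_right (le_add_of_nonneg_left zero_le_one) hBG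
  have hr368' : δP + 2 * ((2 * α + β) * δ₀) ≤ (1 - α'') * ρ₁ := by
    have h3 : B9Ineq368Vprime.rateC α'' ρ₁ ≤ (1 - α'') * ρ₁ := by
      have h4 : 0 ≤ 2 * α'' * ρ₁ := mul_nonneg (mul_nonneg zero_le_two hα''0) hρ₁
      unfold B9Ineq368Vprime.rateC
      linarith only [h4]
    exact hr368.trans h3
  -- the shapes `B9Ineq368Vprime` reads (3.37)/(3.35)/stencil geometry in
  have hA' : ∀ μ x, ‖A μ x‖ ≤ α₁ * (g.len (blk x))⁻¹ ∧ ‖tauB T U μ (A μ) x‖ ≤ α₁ * (g.len (blk x))⁻¹ :=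
    fun μ x => ⟨hA μ x, hAτB μ μ x⟩
  have h337s' : ∀ μ x, ‖((g.eta : ℂ)⁻¹) • covDstar T U μ (A μ) x‖ ≤ α₁ * (g.len (blk x) ^ 2)⁻¹ := fun μ x => h337B μ μ x
  have h337F' : ∀ μ x, ‖((g.eta : ℂ)⁻¹) • covD T U μ (A μ) x‖ ≤ α₁ * (g.len (blk x) ^ 2)⁻¹ := fun μ x => h337F μ μ x
  have hd₀' : ∀ μ x, g.dist (blk x) (blk (T μ x)) ≤ d₀ ∧ g.dist (blk x) (blk ((T μ).symm x)) ≤ d₀ :=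
    fun μ x => ⟨hd₀F μ x, hd₀B μ x⟩
  -- Theorem 3.1's entries for `G′(U)` in FILE 13's two-space shapes, common constant `(1 + card κ)B_G` (FILE 14)
  have hw1 : ∀ a : g.Site, 0 ≤ g.len a := fun a => (hlen a).le
  have hGp' : HasMajorant (g := toB6 g Rr H) (fun p : S × ι => blk p.1) Gp
      (fun a a' => (1 + Fintype.card κ) * BG * g.len a ^ 2 * Real.exp (-(δG * g.dist a a'))) :=
    hasMajorant_mono _ h342_1 fun a a' =>
      mul_le_mul_of_nonneg_right (mul_le_mul_of_nonneg_right hBGle (sq_nonneg _)) (Real.exp_nonneg _)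
  have hDGp' : HasMajorantHom (g := toB6 g Rr H) (fun p : S × ι => blk p.1) (fun q : (κ × S) × ι => blk q.1.2)
      (conjHom b (gradLin T ((g.eta : ℂ)⁻¹) U) ∘ₗ Gp) (fun a a' => (1 + Fintype.card κ) * BG * g.len a * Real.exp (-(δG * g.dist a a'))) :=
    hasMajorantHom_mono _ _ (hasMajorantHom_gradLin (R := Rr) (H := H) b T U blk ((g.eta : ℂ)⁻¹) fun μ => h342_2 (Sum.inl μ))
      fun a a' => mul_le_mul_of_nonneg_right (mul_le_mul_of_nonneg_right hBGle (hw1 a)) (Real.exp_nonneg _)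
  have hGpDs' : HasMajorantHom (g := toB6 g Rr H) (fun q : (κ × S) × ι => blk q.1.2) (fun p : S × ι => blk p.1)
      (Gp ∘ₗ conjHom b (divLin T ((g.eta : ℂ)⁻¹) U)) (fun a a' => (1 + Fintype.card κ) * BG * g.len a * Real.exp (-(δG * g.dist a a'))) :=
    hasMajorantHom_mono _ _ (hasMajorantHom_divLin (R := Rr) (H := H) b T U blk ((g.eta : ℂ)⁻¹) fun ν => h342_3 (Sum.inr ν))
      fun a a' => by
        calc (Fintype.card κ : ℝ) * (BG * g.len a * Real.exp (-(δG * g.dist a a')))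
            = Fintype.card κ * BG * g.len a * Real.exp (-(δG * g.dist a a')) := by ring
          _ ≤ (1 + Fintype.card κ) * BG * g.len a * Real.exp (-(δG * g.dist a a')) :=
            mul_le_mul_of_nonneg_right (mul_le_mul_of_nonneg_right hκBGle (hw1 a)) (Real.exp_nonneg _)
  have hQp' : HasMajorantHom (g := toB6 g Rr H) (fun p : S × ι => blk p.1) (fun p : S × ι => blk p.1) Qp
      (fun a a' : g.Site => if a = a' then κQ else 0) := (hasMajorantHom_iff (g := toB6 g Rr H) _ _ _).mpr hQp
  have hQps' : HasMajorantHom (g := toB6 g Rr H) (fun p : S × ι => blk p.1) (fun p : S × ι => blk p.1) Qps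
      (fun a a' : g.Site => if a = a' then κQ else 0) := (hasMajorantHom_iff (g := toB6 g Rr H) _ _ _).mpr hQps
  -- the four (3.68) entries of the CONCRETE `P′(A)` (gen 9/10), at the rate `δ_P`
  have e1 := ineq368_op_conc (Rr := Rr) (H := H) b T U blk d hη A kQ kF sQ sF cfun w 1 d₀ M₂ Cq a₀ δ₀ δG α β ρ₁ α'' δP Λ BG κQ cF κC B₁
    Bc' α₁ hκQ hcF hκC hB₁ hBc' hBG hα₁ hΛ hρ₁ hδP0 hα hβ hδ₀ hδG0 hr1 hα''0 hα''1 hr368' hdnn hrefl htri hlen h261 h261'' hT1 hT2 hT4 hM₂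
    hrepr hsmall hA' h337s' hU1 hd₀' hd₀0 hw hcard hCq ha₀ hkQ hkF hsQ hsF hcfun hθ h342_1 h342_2 h357p h357ps hCC hQp hQps hFp hFps hCinv
    hCinv' hCp
  have e2 : ∀ μ : κ, _ := fun μ =>
    ineq368_op_D_conc (Rr := Rr) (H := H) b T U blk d hη A kQ kF sQ sF cfun w 1 d₀ M₂ Cq a₀ δ₀ δG α β ρ₁ α'' δP Λ BG BG κQ cF κC
      B₁ Bc' α₁ hκQ hcF hκC hB₁ hBc' hBG hBG hα₁ hΛ hρ₁ hδP0 hα hβ hδ₀ hδG0 hr1 hα''0 hα''1 hr368' hdnn hrefl htri hlen h261 h261'' hT1 hT2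
      hT4 hM₂ hrepr hsmall hA' h337s' hU1 hd₀' hd₀0 hw hcard hCq ha₀ hkQ hkF hsQ hsF hcfun hθ (D₀ := conj b (diffLetter T U ((g.eta : ℂ)⁻¹) (Sum.inl μ)))
      (h342L := h342_2 (Sum.inl μ)) h342_1 h342_2 h357p h357ps hCC hQp hQps hFp hFps hCinv hCinv' hCp
  have e3 : ∀ ν : κ, _ := fun ν =>
    ineq368_op_Ds_conc (Rr := Rr) (H := H) b T U blk d hη A kQ kF sQ sF cfun w 1 d₀ M₂ Cq a₀ δ₀ δG α β ρ₁ α'' δP Λ Λρ₁ BG κQ cF κC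
      B₁ Bc' α₁ hκQ hcF hκC hB₁ hBc' hBG hα₁ hΛ hΛρ₁ hρ₁ hδP0 hα hβ hδ₀ hδG0 hr1 hα''1 hα''0 hα''ρ hα''ρ2 hα''ρ3 hr368 hdnn hrefl hsym htri
      hlen h261 h261'' hT1 hT2 hT1i hT2i hT4 hTρ₁ hM₂ hrepr hsmall hA' h337s' h337F' h337Bτ hU1 hd₀' hd₀0 hw hcard hCq ha₀ hkQ hkF hsQ hsF
      hcfun hθ hθL (Ds := conj b (diffLetter T U ((g.eta : ℂ)⁻¹) (Sum.inr ν))) h342_1 h342_2 h342_3 (h342R := h342_3 (Sum.inr ν)) h357p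
      h357ps hCC hQp hQps hFp hFps hCinv hCinv' hCp
  have e4 : ∀ μ ν : κ, _ := fun μ ν =>
    ineq368_op_DDs_conc (Rr := Rr) (H := H) b T U blk d hη A kQ kF sQ sF cfun w 1 d₀ M₂ Cq a₀ δ₀ δG α β ρ₁ α'' δP Λ Λρ₁ BG BG κQ cF
      κC B₁ Bc' α₁ hκQ hcF hκC hB₁ hBc' hBG hBG hα₁ hΛ hΛρ₁ hρ₁ hδP0 hα hβ hδ₀ hδG0 hr1 hα''1 hα''0 hα''ρ hα''ρ2 hα''ρ3 hr368 hdnn hrefl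
      hsym htri hlen h261 h261'' hT1 hT2 hT1i hT2i hT4 hTρ₁ hM₂ hrepr hsmall hA' h337s' h337F' h337Bτ hU1 hd₀' hd₀0 hw hcard hCq ha₀ hkQ hkF
      hsQ hsF hcfun hθ hθL (D₀ := conj b (diffLetter T U ((g.eta : ℂ)⁻¹) (Sum.inl μ)))
      (Ds := conj b (diffLetter T U ((g.eta : ℂ)⁻¹) (Sum.inr ν))) h342_1 h342_2 h342_3 (h342R := h342_3 (Sum.inr ν))
      (h342L := h342_2 (Sum.inl μ)) h357p h357ps hCC hQp hQps hFp hFps hCinv hCinv' hCp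
  dsimp only at e1 e2 e3 e4
  -- the four `P′`-entry hypotheses of FILE 13, constants weakened to `κ_{P′}`
  have hPp := hasMajorant_mono (g := toB6 g Rr H) _ e1 fun a a' =>
    mul_le_mul_of_nonneg_right (mul_le_mul_of_nonneg_right hK1 hα₁) (Real.exp_nonneg (-(δP * g.dist a a')))
  have hDPp := hasMajorantHom_gradLin_comp (R := Rr) (H := H) b T U blk ((g.eta : ℂ)⁻¹) fun μ =>
    hasMajorant_mono (g := toB6 g Rr H) _ (e2 μ) fun a a' =>
      mul_le_mul_of_nonneg_right (mul_le_mul_of_nonneg_right (mul_le_mul_of_nonneg_right hK1 hα₁) (inv_nonneg.mpr (hw1 a)))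
        (Real.exp_nonneg (-(δP * g.dist a a')))
  have aux : ∀ K a1 li e : ℝ, (Fintype.card κ : ℝ) * K ≤ κP' → 0 ≤ a1 → 0 ≤ li → 0 ≤ e →
      (Fintype.card κ : ℝ) * (K * a1 * li * e) ≤ κP' * a1 * li * e := by
    intro K a1 li e hK ha1 hli he
    calc (Fintype.card κ : ℝ) * (K * a1 * li * e) = Fintype.card κ * K * a1 * li * e := by ring
      _ ≤ κP' * a1 * li * e := mul_le_mul_of_nonneg_right (mul_le_mul_of_nonneg_right (mul_le_mul_of_nonneg_right hK ha1) hli) he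
  have hPpDs := hasMajorantHom_mono (g := toB6 g Rr H) _ _
    (hasMajorantHom_comp_divLin (R := Rr) (H := H) b T U blk ((g.eta : ℂ)⁻¹) e3) fun a a' =>
      aux _ _ _ _ hK3 hα₁ (inv_nonneg.mpr (hw1 a)) (Real.exp_nonneg (-(δP * g.dist a a')))
  have hDPpDs := hasMajorant_mono (g := toB6 g Rr H) _
    (hasMajorant_gradLin_comp_comp_divLin (R := Rr) (H := H) b T U blk ((g.eta : ℂ)⁻¹) e4) fun a a' =>
      aux _ _ _ _ hK3 hα₁ (inv_nonneg.mpr (sq_nonneg (g.len a))) (Real.exp_nonneg (-(δP * g.dist a a')))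
  exact thm34_G_entries13_concreteP (Rr := Rr) (H := H) b T U blk d δ₀ δ δP δG α β ρ α' Λ Λρ B₀ κQ ((1 + Fintype.card κ) * BG) B₁ κP κP' κ₁
    κ₂ α₁ C₀ d₀ M₂ hB₀ hκQ hBG' hB₁ hκP' hκ₂ hα₁ hC₀ hΛ hΛρ hρ hα hβ hδ₀ hδ hM₂ hr hrP hrG hκP hα' hα'ρ0 hα'ρ2 hκ₁ hdnn htri hrefl hsym hlen
    h261 h261' hT1 hT2 hT1i hT2i hT4 hTρ hsmall385 hrepr hη hL A hT hsmall hU1 h337B h337F h337B' h337Bτ h337FB hA hAτB hAτF hAFB hAst hAloc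
    hdAst h35 hd₀B hd₀F hd₀FB hd₀st hd₀loc hd₀0 (fun p : S × ι => blk p.1) hQp' hQps' hGp' hDGp' hGpDs' hCinv hPp hDPp hPpDs hDPpDs h380 h380s
    hP₂def hΔG hGΔ hP₂ hG hDG hGD hGDs

end Assembly

end Literature.MathematicalPhysics.QuantumFieldTheory.Balaban1983to89.B9Thm34GConcrete

end
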